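import Summits.KontsevichZagierPeriods.KontsevichZagierPeriods.Theses.IsogenyCertificates
import Summits.KontsevichZagierPeriods.KontsevichZagierPeriods.Theorems.XMapKernel.Negative.Core
import Summits.KontsevichZagierPeriods.KontsevichZagierPeriods.Theorems.IsogenyCertificatesXMapKernelIffSummit
import Literature.NumberTheory.Transcendental.KZRelationsLE

/-!
# Strategist sketch P1 (wall-breaker seat, 2026-08-17) — crux `XMapKernel` (stmt-KontsevichZagierPeriods-10663)

Companion to `Cruxes/XMapKernel/STRATEGY-CENSUS.md` (wall-breaker edition). Kernel-checked shapes of the two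
decomposition attempts that are NOT of the dead form "cell + remainder K" with `K := ReducesTo S`:

* **D6 (normal-form split).** `StrongReduce N ∧ CellKernel N → XMapKernel`, where `StrongReduce N` (EVERY formal
  combination — not only kernel elements — is congruent modulo the move group to an element of the normal-form
  sector `N`) is a value-blind CALCULUS statement: it is *not* a consequence of the crux alone; given the crux it is
  equivalent to `ValueUniversal N` (`strongReduce_iff_valueUniversal_of_crux`). This is the one split shape in
  which the summit-strength piece (`CellKernel N`) is transformed by the other piece instead of being `K` in
  disguise — and `cell_iff_crux_of_strongReduce` records the price: once `StrongReduce N` is a theorem, the cell IS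
  the crux. The census lists every value-universal `N` with a non-trivial `StrongReduce` and the route owning it.
* **D5′ (graded split).** `CellKernel (formalRepLE 0) ∧ (∀ d, GradedStep d) → XMapKernel` by induction on the
  dimension filtration (`crux_of_gradedSteps`), each `GradedStep d` ("kernel elements of dimension ≤ d+1 reduce
  modulo moves to dimension ≤ d") strictly a special case of the crux; but every finite cut leaves a tail
  `∀ d ≥ d₀, GradedStep d` that is the crux again given the head cell (`tail_iff_crux_of_cell`).

No `sorry`. Nothing here has a route decl as a bare conclusion except from hypotheses that are themselves
decomposition pieces (audit: conditional).
-/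

noncomputable section

set_option linter.dupNamespace false

namespace Summit.KontsevichZagierPeriods.KontsevichZagierPeriods.Cruxes.XMapKernel.StrategistSketchP1

open Literature.NumberTheory.Transcendental
open Summit.KontsevichZagierPeriods.KontsevichZagierPeriods.Theses.IsogenyCertificates
open Summit.KontsevichZagierPeriods.XMapKernel.Negative
open Summit.KontsevichZagierPeriods.IsogenyCertificates

/-! ## §0 Vocabulary (as in the gen-1 sketch and the landed `XMapKernelIffSummit`) -/

/-- The kernel conjecture restricted to a sector `S` (a CELL). -/
def CellKernel (S : AddSubgroup KZ.FormalRep) : Prop :=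
  ∀ c ∈ S, KZ.eval c = 0 → c ∈ AddSubgroup.closure gens

/-- The remainder stub `K` of every dead line: kernel elements reduce to `S` modulo the move group. -/
def ReducesTo (S : AddSubgroup KZ.FormalRep) : Prop :=
  ∀ c : KZ.FormalRep, KZ.eval c = 0 → ∃ c' ∈ S, c - c' ∈ AddSubgroup.closure gens

/-- The dead shape, recalled: given the cell, `K ↔ crux ↔ summit` (landed, p116992). -/
theorem reducesTo_iff_summit_of_cell (S : AddSubgroup KZ.FormalRep) (hC : CellKernel S) :
    ReducesTo S ↔ _root_.KontsevichZagierPeriods :=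
  XMapKernelIffSummit.reduction_iff_summit_of_cell S hC

/-! ## §1 D6 — the normal-form split -/

/-- **Strong (value-blind) normal-form reduction**: EVERY formal combination is congruent modulo the move
group to an element of the sector `N`. A statement about the expressive power of the calculus; no `eval`
hypothesis. -/
def StrongReduce (N : AddSubgroup KZ.FormalRep) : Prop :=
  ∀ c : KZ.FormalRep, ∃ n ∈ N, c - n ∈ AddSubgroup.closure gens

/-- `N` represents every value that some formal combination has. -/
def ValueUniversal (N : AddSubgroup KZ.FormalRep) : Prop :=
  ∀ c : KZ.FormalRep, ∃ n ∈ N, KZ.eval n = KZ.eval c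

theorem reducesTo_of_strongReduce (N : AddSubgroup KZ.FormalRep) (h : StrongReduce N) : ReducesTo N :=
  fun c _ => h c

/-- **D6 glue.** Normal form + cell ⇒ crux. -/
theorem crux_of_strongReduce_of_cell (N : AddSubgroup KZ.FormalRep) (hN : StrongReduce N) (hC : CellKernel N) :
    XMapKernel :=
  (XMapKernelIffSummit.reduction_iff_xMapKernel_of_cell N hC).1 (reducesTo_of_strongReduce N hN)

/-- Soundness: a strong normal form is value-universal. -/
theorem valueUniversal_of_strongReduce (N : AddSubgroup KZ.FormalRep) (h : StrongReduce N) : ValueUniversal N := by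
  intro c
  obtain ⟨n, hn, hcn⟩ := h c
  refine ⟨n, hn, ?_⟩
  have h0 := AddMonoidHom.mem_ker.1 (closure_gens_le_ker_eval hcn)
  rw [map_sub, sub_eq_zero] at h0
  exact h0.symm

/-- Given the crux, value-universality is all that a strong normal form adds. -/
theorem strongReduce_of_crux_of_valueUniversal (N : AddSubgroup KZ.FormalRep) (hX : XMapKernel)
    (hU : ValueUniversal N) : StrongReduce N := by
  intro c
  obtain ⟨n, hn, hv⟩ := hU c
  refine ⟨n, hn, (crux_iff.1 hX) (c - n) ?_⟩
  rw [map_sub, hv, sub_self]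

/-- `StrongReduce N ↔ ValueUniversal N` GIVEN the crux — i.e. `StrongReduce` is NOT a piece of the crux: its
content beyond value-universality is exactly a proof of Conjecture 1 for pairs (c, n). -/
theorem strongReduce_iff_valueUniversal_of_crux (N : AddSubgroup KZ.FormalRep) (hX : XMapKernel) :
    StrongReduce N ↔ ValueUniversal N :=
  ⟨valueUniversal_of_strongReduce N, strongReduce_of_crux_of_valueUniversal N hX⟩

/-- **The price of D6.** Once the normal-form theorem is in hand, the cell on `N` IS the crux (hence the summit). -/
theorem cell_iff_crux_of_strongReduce (N : AddSubgroup KZ.FormalRep) (hN : StrongReduce N) :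
    CellKernel N ↔ XMapKernel :=
  ⟨crux_of_strongReduce_of_cell N hN, fun hX c _ hc => (crux_iff.1 hX) c hc⟩

theorem cell_iff_summit_of_strongReduce (N : AddSubgroup KZ.FormalRep) (hN : StrongReduce N) :
    CellKernel N ↔ _root_.KontsevichZagierPeriods :=
  (cell_iff_crux_of_strongReduce N hN).trans XMapKernelIffSummit.xMapKernel_iff_summit

/-! ## §2 D5′ — the graded split along the dimension filtration -/

/-- **Graded step `d`**: every kernel element supported in dimension `≤ d+1` is congruent modulo the move group
to one supported in dimension `≤ d`. A special case of the crux for each fixed `d`. -/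
def GradedStep (d : ℕ) : Prop :=
  ∀ c ∈ KZ.formalRepLE (d + 1), KZ.eval c = 0 → ∃ c' ∈ KZ.formalRepLE d, c - c' ∈ AddSubgroup.closure gens

theorem gradedStep_of_crux (hX : XMapKernel) (d : ℕ) : GradedStep d :=
  fun c _ hc => ⟨0, AddSubgroup.zero_mem _, by simpa using (crux_iff.1 hX) c hc⟩

/-- Head cell + graded steps from `d₀` on ⇒ every dimension-bounded cell. -/
theorem cellLE_of_gradedStepsFrom (d₀ : ℕ) (h0 : CellKernel (KZ.formalRepLE d₀))
    (hS : ∀ d, d₀ ≤ d → GradedStep d) : ∀ k, CellKernel (KZ.formalRepLE (d₀ + k)) := by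
  intro k
  induction k with
  | zero => simpa using h0
  | succ k ih =>
    intro c hc h0c
    have hc1 : c ∈ KZ.formalRepLE (d₀ + k + 1) := by simpa [Nat.add_assoc] using hc
    obtain ⟨c', hc', hcc'⟩ := hS (d₀ + k) (Nat.le_add_right _ _) c hc1 h0c
    have hdiff : KZ.eval (c - c') = 0 := AddMonoidHom.mem_ker.1 (closure_gens_le_ker_eval hcc')
    have hc'0 : KZ.eval c' = 0 := by
      rw [map_sub, h0c, zero_sub, neg_eq_zero] at hdiff
      exact hdiff
    have hsplit : c = (c - c') + c' := by abel
    rw [hsplit]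
    exact AddSubgroup.add_mem _ hcc' (ih c' hc' hc'0)

/-- Every formal combination is supported in some bounded dimension. -/
theorem exists_mem_formalRepLE (c : KZ.FormalRep) : ∃ d, c ∈ KZ.formalRepLE d := by
  have hdir : Directed (· ≤ ·) KZ.formalRepLE :=
    Monotone.directed_le fun _ _ h => KZ.formalRepLE_mono h
  exact (AddSubgroup.mem_iSup_of_directed hdir).1 (KZ.mem_iSup_formalRepLE c)

/-- **D5′ glue, general head.** The cell up to dimension `d₀` and the graded steps from `d₀` on ⇒ crux. -/
theorem crux_of_cell_of_gradedStepsFrom (d₀ : ℕ) (h0 : CellKernel (KZ.formalRepLE d₀))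
    (hS : ∀ d, d₀ ≤ d → GradedStep d) : XMapKernel := by
  rw [crux_iff]
  intro c hc
  obtain ⟨d, hd⟩ := exists_mem_formalRepLE c
  have hd' : c ∈ KZ.formalRepLE (d₀ + d) := KZ.formalRepLE_mono (Nat.le_add_left _ _) hd
  exact cellLE_of_gradedStepsFrom d₀ h0 hS d c hd' hc

/-- **D5′ glue.** Dimension-`0` cell + all graded steps ⇒ crux. -/
theorem crux_of_gradedSteps (h0 : CellKernel (KZ.formalRepLE 0)) (hS : ∀ d, GradedStep d) : XMapKernel :=
  crux_of_cell_of_gradedStepsFrom 0 h0 fun d _ => hS d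

/-- **The price of D5′.** Every finite cut leaves a tail that is the crux again, given the head cell. -/
theorem tail_iff_crux_of_cell (d₀ : ℕ) (h0 : CellKernel (KZ.formalRepLE d₀)) :
    (∀ d, d₀ ≤ d → GradedStep d) ↔ XMapKernel :=
  ⟨crux_of_cell_of_gradedStepsFrom d₀ h0, fun hX d _ => gradedStep_of_crux hX d⟩

theorem tail_iff_summit_of_cell (d₀ : ℕ) (h0 : CellKernel (KZ.formalRepLE d₀)) :
    (∀ d, d₀ ≤ d → GradedStep d) ↔ _root_.KontsevichZagierPeriods :=
  (tail_iff_crux_of_cell d₀ h0).trans XMapKernelIffSummit.xMapKernel_iff_summit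

end Summit.KontsevichZagierPeriods.KontsevichZagierPeriods.Cruxes.XMapKernel.StrategistSketchP1
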